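import Mathlib
import HarnessLib
import Literature.NumberTheory.Transcendental.PeriodsWave0
import Summits.KontsevichZagierPeriods.Zeta5Search.Denom.KernelStripStep
import Summits.KontsevichZagierPeriods.Zeta5Search.Denom.KernelSechSq
import Summits.KontsevichZagierPeriods.Zeta5Search.Denom.KernelResidueStep

/-!
# Zudilin 2014, Lemma 2 in the kernel: `(1/2πi)∫_{½−i∞}^{½+i∞} (π/sin πt)² dt/(t+k) = ζ(2) − Σ_{ℓ≤k} ℓ⁻²`

HONEST FRAMING: systematic search; no irrationality claim unless certified.  Pure complex analysis; the
only zeta value that appears is `ζ(2) = Σ n⁻²` as the DEFINED constant `zetaValue 2`, about which nothing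
arithmetic is claimed.

[Zudilin2014ZetaTwo, Lemma 2] (arXiv:1310.1526, p. 4; proved there by `(π/sin πt)² dt = d(−π cot πt)`,
partial integration and rectangles):  for `k = 0, 1, 2, …`,
`(1/2πi)∫_{½−i∞}^{½+i∞} (π/sin πt)² dt/(t+k) = Σ_{m≥1} (m+k)⁻² = ζ(2) − Σ_{ℓ=1}^{k} ℓ⁻²`; it supplies the
`ζ(2)`- and `Σ ℓ⁻²`-terms of Proposition 1 (`Literature…Zudilin2014.formQ/formP`).  Here it is PROVED by
residues: `g(t) = 1/(t+k)` is holomorphic on `Re t ≥ ½` with `g′(m) = −(m+k)⁻²`, so the residue step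
(`KernelResidueStep.integral_kernel_residue_step`) across each integer `m ≥ 1` gives
`L(m−½) = L(m+½) + 2π/(m+k)²` for the profile integrals `L(x) = ∫ π²/cosh²(πy) · dy/(x+iy+k)`
(`polarLine`; on half-integer lines the kernel IS this profile, `KernelSechSq.kernel_halfLine`), while
`|L(M+½)| ≤ 2π/(M+½+k) → 0`; hence `L(½) = 2π Σ_{m≥1} (m+k)⁻²` (`polarLine_half_hasSum`,
`polarLine_half_eq`) and the printed form `barnes_lemma_two`.
-/

noncomputable section

open Complex Set MeasureTheory Filter Topology Finset
open Literature.NumberTheory.Transcendental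
open Summit.KontsevichZagierPeriods.Zeta5Search.Denom.KernelStripStep
open Summit.KontsevichZagierPeriods.Zeta5Search.Denom.KernelSechSq
open Summit.KontsevichZagierPeriods.Zeta5Search.Denom.KernelResidueStep

namespace Summit.KontsevichZagierPeriods.Zeta5Search.Denom.KernelPolarMoment

/-! ### The polar test function `1/(t+k)` on the strips `|Re t − m| ≤ ½`, `m ≥ 1` -/

/-- On `halfStrip m`, `m ≥ 1`: `Re (t + k) ≥ ½`. -/
theorem half_le_re_add_natCast {m k : ℕ} (hm : 1 ≤ m) {t : ℂ} (ht : t ∈ halfStrip (m : ℤ)) :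
    1 / 2 ≤ (t + k).re := by
  simp only [halfStrip, Set.mem_preimage, Set.mem_Icc, Int.cast_natCast] at ht
  rw [add_re, natCast_re]
  have h1 : (1 : ℝ) ≤ m := by exact_mod_cast hm
  have hk : (0 : ℝ) ≤ k := Nat.cast_nonneg k
  linarith [ht.1]

/-- On `halfStrip m`, `m ≥ 1`: `t + k ≠ 0`. -/
theorem add_natCast_ne_zero {m k : ℕ} (hm : 1 ≤ m) {t : ℂ} (ht : t ∈ halfStrip (m : ℤ)) :
    t + k ≠ 0 := by
  intro h
  have := half_le_re_add_natCast (k := k) hm ht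
  rw [h, zero_re] at this
  linarith

/-- `‖1/(t+k)‖ ≤ 2` on `halfStrip m`, `m ≥ 1` (growth exponent `0`). -/
theorem norm_inv_add_natCast_le {m k : ℕ} (hm : 1 ≤ m) :
    ∀ t ∈ halfStrip (m : ℤ), ‖1 / (t + k)‖ ≤ 2 * (1 + t.im ^ 2) ^ 0 := by
  intro t ht
  have hre := half_le_re_add_natCast (k := k) hm ht
  have hn : 1 / 2 ≤ ‖t + (k : ℂ)‖ := hre.trans (Complex.re_le_norm _)
  rw [pow_zero, mul_one, norm_div, norm_one]
  rw [div_le_iff₀ (by linarith)]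
  linarith

/-- `1/(t+k)` is holomorphic on `halfStrip m`, `m ≥ 1`. -/
theorem differentiableOn_inv_add_natCast {m : ℕ} (hm : 1 ≤ m) (k : ℕ) :
    DifferentiableOn ℂ (fun t : ℂ => 1 / (t + k)) (halfStrip (m : ℤ)) := by
  have hden : ∀ t ∈ halfStrip (m : ℤ), t + (k : ℂ) ≠ 0 := fun t ht => add_natCast_ne_zero hm ht
  fun_prop (disch := first | assumption | exact hden)

/-- `(1/(t+k))′ (m) = −1/(m+k)²`. -/
theorem deriv_inv_add_natCast {m : ℕ} (hm : 1 ≤ m) (k : ℕ) :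
    deriv (fun t : ℂ => 1 / (t + k)) (m : ℂ) = -1 / ((m : ℂ) + k) ^ 2 := by
  have hne : (m : ℂ) + k ≠ 0 := by
    intro h
    have h2 := congrArg Complex.re h
    simp only [add_re, natCast_re, zero_re] at h2
    have h1 : (1 : ℝ) ≤ m := by exact_mod_cast hm
    have hk : (0 : ℝ) ≤ k := Nat.cast_nonneg k
    linarith
  have hd : HasDerivAt (fun t : ℂ => t + k) 1 (m : ℂ) := (hasDerivAt_id' (m : ℂ)).add_const _
  have h : HasDerivAt (fun t : ℂ => 1 / (t + k)) ((0 * ((m : ℂ) + k) - 1 * 1) / ((m : ℂ) + k) ^ 2) (m : ℂ) :=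
    (hasDerivAt_const (m : ℂ) (1 : ℂ)).div hd hne
  rw [h.deriv]
  ring

/-! ### The profile line integrals `L(x) = ∫ π²/cosh²(πy) · dy/(x + iy + k)` -/

/-- `L_k(x) = ∫_ℝ π²/cosh²(πy) · (x + iy + k)⁻¹ dy`. -/
def polarLine (k : ℕ) (x : ℝ) : ℂ := ∫ y : ℝ, ((sechSq y : ℝ) : ℂ) * (1 / ((x : ℂ) + (y : ℂ) * I + k))

/-- **One step to the right**: `L_k(m − ½) = L_k(m + ½) + 2π/(m+k)²` for integers `m ≥ 1`. -/
theorem polarLine_step {m : ℕ} (hm : 1 ≤ m) (k : ℕ) :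
    polarLine k ((m : ℝ) - 1 / 2) = polarLine k ((m : ℝ) + 1 / 2) + 2 * Real.pi / ((m : ℂ) + k) ^ 2 := by
  have step := integral_kernel_residue_step (differentiableOn_inv_add_natCast hm k)
    (norm_inv_add_natCast_le (k := k) hm)
  have kL : ∀ y : ℝ, ((Real.pi : ℂ) / Complex.sin (Real.pi *
      ((((((m : ℤ) : ℝ)) - 1 / 2 : ℝ) : ℂ) + (y : ℂ) * I))) ^ 2 = ((sechSq y : ℝ) : ℂ) :=
    fun y => kernel_halfLine (cos_pi_mul_intCast_sub_half (m : ℤ)) y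
  have kR : ∀ y : ℝ, ((Real.pi : ℂ) / Complex.sin (Real.pi *
      ((((((m : ℤ) : ℝ)) + 1 / 2 : ℝ) : ℂ) + (y : ℂ) * I))) ^ 2 = ((sechSq y : ℝ) : ℂ) :=
    fun y => kernel_halfLine (cos_pi_mul_intCast_add_half (m : ℤ)) y
  simp only [kL, kR] at step
  simp only [Int.cast_natCast] at step
  rw [deriv_inv_add_natCast hm k] at step
  unfold polarLine
  rw [step]
  ring

/-- Iterating: `L_k(½) = L_k(M + ½) + 2π Σ_{j<M} (j+k+1)⁻²`. -/
theorem polarLine_half_eq_add_sum (k M : ℕ) :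
    polarLine k (1 / 2) = polarLine k ((M : ℝ) + 1 / 2) +
      2 * Real.pi * ∑ j ∈ range M, (1 : ℂ) / (((j + (k + 1) : ℕ) : ℂ)) ^ 2 := by
  induction M with
  | zero => simp
  | succ M ih =>
    have h := polarLine_step (m := M + 1) (by omega) k
    have e : ((M + 1 : ℕ) : ℝ) - 1 / 2 = (M : ℝ) + 1 / 2 := by
      push_cast
      ring
    rw [e] at h
    rw [ih, h, sum_range_succ]
    push_cast
    ring

/-- The far lines decay: `‖L_k(M + ½)‖ ≤ 2π/(M + ½ + k)`. -/
theorem norm_polarLine_le (k M : ℕ) : ‖polarLine k ((M : ℝ) + 1 / 2)‖ ≤ 2 * Real.pi / ((M : ℝ) + 1 / 2 + k) := by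
  have hpos : (0 : ℝ) < (M : ℝ) + 1 / 2 + k := by positivity
  unfold polarLine
  have hb : ∀ y : ℝ, ‖((sechSq y : ℝ) : ℂ) * (1 / ((((M : ℝ) + 1 / 2 : ℝ) : ℂ) + (y : ℂ) * I + k))‖ ≤
      sechSq y * (1 / ((M : ℝ) + 1 / 2 + k)) := by
    intro y
    rw [norm_mul, Complex.norm_real, Real.norm_eq_abs, abs_of_nonneg (sechSq_nonneg y), norm_div, norm_one]
    refine mul_le_mul_of_nonneg_left ?_ (sechSq_nonneg y)
    have hre : ((((M : ℝ) + 1 / 2 : ℝ) : ℂ) + (y : ℂ) * I + k).re = (M : ℝ) + 1 / 2 + k := by simp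
    have hn : (M : ℝ) + 1 / 2 + k ≤ ‖(((M : ℝ) + 1 / 2 : ℝ) : ℂ) + (y : ℂ) * I + k‖ := by
      rw [← hre]
      exact Complex.re_le_norm _
    exact one_div_le_one_div_of_le hpos hn
  refine (norm_integral_le_of_norm_le ((integrable_sechSq.mul_const _)) (Eventually.of_forall hb)).trans ?_
  rw [integral_mul_const, integral_sechSq]
  exact le_of_eq (by ring)

/-- `L_k(M + ½) → 0` as `M → ∞`. -/
theorem tendsto_polarLine : ∀ k : ℕ, Tendsto (fun M : ℕ => polarLine k ((M : ℝ) + 1 / 2)) atTop (𝓝 0) := by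
  intro k
  rw [tendsto_zero_iff_norm_tendsto_zero]
  have h1 : Tendsto (fun M : ℕ => (M : ℝ) + 1 / 2 + k) atTop atTop :=
    tendsto_atTop_add_const_right _ _ (tendsto_atTop_add_const_right _ _ tendsto_natCast_atTop_atTop)
  have h2 : Tendsto (fun M : ℕ => 2 * Real.pi / ((M : ℝ) + 1 / 2 + k)) atTop (𝓝 0) :=
    tendsto_const_nhds.div_atTop h1
  exact squeeze_zero (fun _ => norm_nonneg _) (norm_polarLine_le k) h2

/-! ### The value `L_k(½) = 2π Σ_{m≥1} (m+k)⁻² = 2π (ζ(2) − Σ_{ℓ≤k} ℓ⁻²)` -/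

/-- **`L_k(½) = 2π · Σ_{j≥0} (j+k+1)⁻²`** as a convergent series. -/
theorem polarLine_half_hasSum (k : ℕ) :
    HasSum (fun j : ℕ => 2 * (Real.pi : ℂ) * (1 / (((j + (k + 1) : ℕ) : ℂ)) ^ 2)) (polarLine k (1 / 2)) := by
  have hsR : Summable fun j : ℕ => (1 : ℝ) / ((j + (k + 1) : ℕ) : ℝ) ^ 2 :=
    (summable_nat_add_iff (f := fun n : ℕ => (1 : ℝ) / (n : ℝ) ^ 2) (k + 1)).2
      (Real.summable_one_div_nat_pow.mpr one_lt_two)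
  have hsC : Summable fun j : ℕ => 2 * (Real.pi : ℂ) * (1 / (((j + (k + 1) : ℕ) : ℂ)) ^ 2) := by
    have h := (Complex.summable_ofReal.2 hsR).mul_left (2 * (Real.pi : ℂ))
    refine h.congr fun j => ?_
    push_cast
    ring
  have ht := hsC.hasSum.tendsto_sum_nat
  have hps : (fun M : ℕ => ∑ j ∈ range M, 2 * (Real.pi : ℂ) * (1 / (((j + (k + 1) : ℕ) : ℂ)) ^ 2)) =
      fun M : ℕ => polarLine k (1 / 2) - polarLine k ((M : ℝ) + 1 / 2) := by
    funext M
    rw [polarLine_half_eq_add_sum k M, mul_sum]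
    ring
  rw [hps] at ht
  have hlim : Tendsto (fun M : ℕ => polarLine k (1 / 2) - polarLine k ((M : ℝ) + 1 / 2)) atTop
      (𝓝 (polarLine k (1 / 2) - 0)) := tendsto_const_nhds.sub (tendsto_polarLine k)
  rw [sub_zero] at hlim
  rw [← tendsto_nhds_unique ht hlim]
  exact hsC.hasSum

/-- The tail of `Σ n⁻²`: `Σ_{j≥0} (j+k+1)⁻² = ζ(2) − Σ_{i≤k} i⁻²` (with the harmless `i = 0` term `= 0`). -/
theorem tsum_inv_sq_tail_eq (k : ℕ) :
    ∑' j : ℕ, (1 : ℝ) / ((j + (k + 1) : ℕ) : ℝ) ^ 2 =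
      zetaValue 2 - ∑ i ∈ range (k + 1), (1 : ℝ) / (i : ℝ) ^ 2 := by
  have hs : Summable fun n : ℕ => (1 : ℝ) / (n : ℝ) ^ 2 := Real.summable_one_div_nat_pow.mpr one_lt_two
  have h := hs.sum_add_tsum_nat_add (k + 1)
  rw [zetaValue, ← h]
  ring

/-- **`L_k(½) = 2π (ζ(2) − Σ_{i≤k} i⁻²)`.** -/
theorem polarLine_half_eq (k : ℕ) :
    polarLine k (1 / 2) = 2 * Real.pi * (((zetaValue 2 - ∑ i ∈ range (k + 1), (1 : ℝ) / (i : ℝ) ^ 2 : ℝ) : ℂ)) := by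
  rw [← tsum_inv_sq_tail_eq, ← (polarLine_half_hasSum k).tsum_eq, tsum_mul_left]
  congr 1
  rw [Complex.ofReal_tsum]
  congr 1
  funext j
  push_cast
  ring

/-- **[Zudilin2014ZetaTwo, Lemma 2]** in kernel form on the line `Re t = ½`:
`(1/2π) ∫_ℝ (π/sin π(½+iy))² dy/(½+iy+k) = ζ(2) − Σ_{i≤k} i⁻²` — i.e.
`(1/2πi)∫_{½−i∞}^{½+i∞} (π/sin πt)² dt/(t+k) = ζ(2) − Σ_{ℓ=1}^{k} ℓ⁻²` (`dt = i dy`; the `i = 0` term is `0`). -/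
theorem barnes_lemma_two (k : ℕ) :
    (1 / (2 * Real.pi) : ℂ) * ∫ y : ℝ, ((Real.pi : ℂ) / Complex.sin (Real.pi * (((1 / 2 : ℝ) : ℂ) + (y : ℂ) * I))) ^ 2 *
        (1 / ((((1 / 2 : ℝ) : ℂ) + (y : ℂ) * I) + k)) =
      (((zetaValue 2 - ∑ i ∈ range (k + 1), (1 : ℝ) / (i : ℝ) ^ 2 : ℝ) : ℂ)) := by
  have hcos : Real.cos (Real.pi * (1 / 2)) = 0 := by
    rw [show Real.pi * (1 / 2) = Real.pi / 2 by ring, Real.cos_pi_div_two]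
  have kH : ∀ y : ℝ, ((Real.pi : ℂ) / Complex.sin (Real.pi * (((1 / 2 : ℝ) : ℂ) + (y : ℂ) * I))) ^ 2 =
      ((sechSq y : ℝ) : ℂ) := fun y => kernel_halfLine hcos y
  simp only [kH]
  have h := polarLine_half_eq k
  unfold polarLine at h
  rw [h]
  have hπ : (Real.pi : ℂ) ≠ 0 := by exact_mod_cast Real.pi_ne_zero
  field_simp

end Summit.KontsevichZagierPeriods.Zeta5Search.Denom.KernelPolarMoment

end
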